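import Mathlib
import HarnessLib
import Summits.ResolutionOfSingularities.ResolutionOfSingularities.Theorems.WildQuotientsWildQuotientResolutionS1aKillCert
import Summits.ResolutionOfSingularities.ResolutionOfSingularities.Theorems.WildQuotientsWildQuotientResolutionS1aCobordantAway

/-!
# S1a — COBORDANT KILL CERTIFICATES LOCALISE (at σ-invariant elements): the second-level enabler

[OURS · L1 W4.5c · lead-1 g10; FRAME-STATUS rev10 (F4) «agreement of chart filtrations for two blow-up charts of the SAME move» / §4 item 4] — NOT
statements of the manuscript; counted 0; AI-level work, weaker than expert review. Crux stmt-ResolutionOfSingularities-17941 `CyclicQuotientFourfolds`, line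
`s1a-logminvertex` v10, K-side and the killability clause of the A-side. Route-independent; pure algebra.

A cobordant kill certificate for `(f, w, σ)` over `B` becomes one for `(f/1, w, σ_h)` over `B[h⁻¹]` at every σ-INVARIANT `h` (gen-8 infrastructure:
`cobordantMap : R^w(B) → R^w(B[h⁻¹])` is a localisation, `cobordantMap_sigmaR` the equivariance). Since a chart ring of a weighted blow-up IS such a
localisation — `ChartRing 𝒜 f w d b hb = R^w[(bT^d)⁻¹]` with `σ_R (bT^d) = bT^d` and `sigmaChart = sigmaAway σ_R` — a SECOND-LEVEL centre given ONCE on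
the cobordant algebra `R^w` with its certificate yields certificates on EVERY chart ring of the move (and the chart filtrations of two charts of the same
move are then traces of ONE filtration: agreement is automatic).

* `augmentationIdeal_le_map_of_isLocalization` — if `S = M⁻¹R`, `τ` on `S` is compatible with `σ` on `R` and `σ` FIXES `M` pointwise, then
  `augIdeal τ ≤ (augIdeal σ)·S` (so `=`, with `OneShotKill.map_augmentationIdeal_le`);
* `cobordantMap_u'`, `map_vertexIdeal_cobordantMap` — the vertex ideal extends to the vertex ideal;
* ★★★ `CobordantKillCert.away` — `CobordantKillCert f w σ … g ⇒ CobordantKillCert (f/1) w (sigmaAway σ) … (cobordantMap g)` for `σ h = h`.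
-/

set_option linter.dupNamespace false

noncomputable section

open Literature.AlgebraicGeometry.Resolution
open scoped LaurentPolynomial
open Summit.ResolutionOfSingularities.ResolutionOfSingularities.Theorems.WildQuotientResolution.S1.CoarseChart
open Summit.ResolutionOfSingularities.ResolutionOfSingularities.Theorems.WildQuotientResolution.S1.NodeAway
open Summit.ResolutionOfSingularities.ResolutionOfSingularities.Theorems.WildQuotientResolution.S1.CentreAway
open Summit.ResolutionOfSingularities.ResolutionOfSingularities.Theorems.WildQuotientResolution.S1.PrincipalAway

namespace Summit.ResolutionOfSingularities.ResolutionOfSingularities.Theorems.WildQuotientResolution.S1.KillCert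

universe u

/-! ## Augmentation ideals under localisation at a fixed submonoid -/

/-- **`augIdeal τ ≤ (augIdeal σ) · S`** when `S = M⁻¹R`, `τ ∘ algebraMap = algebraMap ∘ σ` and `σ` fixes `M` pointwise: for `z = a/m`,
`(τ z − z)·m = τ(z m) − z m = (σ a − a)/1`. [OURS · L1 W4.5c] -/
theorem augmentationIdeal_le_map_of_isLocalization {R S : Type*} [CommRing R] [CommRing S] [Algebra R S] (M : Submonoid R)
    [IsLocalization M S] (σ : R ≃+* R) (τ : S ≃+* S) (hcompat : ∀ r : R, τ (algebraMap R S r) = algebraMap R S (σ r))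
    (hfix : ∀ m ∈ M, σ m = m) : augmentationIdeal τ ≤ (augmentationIdeal σ).map (algebraMap R S) := by
  rw [augmentationIdeal, Ideal.span_le]
  rintro _ ⟨z, rfl⟩
  obtain ⟨⟨a, m⟩, e⟩ := IsLocalization.surj M z
  have hm : τ (algebraMap R S (m : R)) = algebraMap R S (m : R) := by rw [hcompat, hfix m m.2]
  have hU : IsUnit (algebraMap R S (m : R)) := IsLocalization.map_units S m
  rw [SetLike.mem_coe, ← Ideal.mul_unit_mem_iff_mem _ hU]
  have key : (τ z - z) * algebraMap R S (m : R) = algebraMap R S (σ a - a) := by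
    rw [sub_mul, e, ← hm, ← map_mul, e, hcompat, map_sub]
  rw [key]
  exact Ideal.mem_map_of_mem _ (sub_mem_augmentationIdeal σ a)

/-! ## Certificates localise -/

section Away

variable {B : Type u} [CommRing B] {c : ℕ} (f : Fin c → B) (w : Fin c → ℕ) (h : B) (σ : B ≃+* B)
  (hσJ : ∀ n : ℕ, ((weightedFiltration f w).ideal n).map (σ : B →+* B) ≤ (weightedFiltration f w).ideal n)
  {p : ℕ} (hp : 0 < p) (hσp : ∀ x : B, (⇑σ)^[p] x = x) (hσh : σ h = h)

/-- Pin: `cobordantMap (fᵢ t^{wᵢ}) = (fᵢ/1) t^{wᵢ}`. -/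
theorem cobordantMap_u' (i : Fin c) :
    cobordantMap f w h (cobordantAlgebra.u' f w i) = cobordantAlgebra.u' (algebraMap B (Localization.Away h) ∘ f) w i := by
  refine Subtype.ext ?_
  rw [coe_cobordantMap, cobordantAlgebra.coe_u', cobordantAlgebra.coe_u', mapRingHom_C_mul_T]
  rfl

/-- The vertex ideal extends to the vertex ideal. -/
theorem map_vertexIdeal_cobordantMap :
    (cobordantAlgebra.vertexIdeal f w).map (cobordantMap f w h) = cobordantAlgebra.vertexIdeal (algebraMap B (Localization.Away h) ∘ f) w := by
  rw [cobordantAlgebra.vertexIdeal, cobordantAlgebra.vertexIdeal, Ideal.map_span]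
  congr 1
  ext x
  constructor
  · rintro ⟨_, ⟨i, rfl⟩, rfl⟩
    exact ⟨i, (cobordantMap_u' f w h i).symm⟩
  · rintro ⟨i, rfl⟩
    exact ⟨_, ⟨i, rfl⟩, cobordantMap_u' f w h i⟩

include hσh in
/-- `σ_R` fixes the image of the invariant `h`. -/
theorem sigmaR_algebraMap_of_fixed : sigmaR σ f w hσJ hp hσp (algebraMap B (↥(cobordantAlgebra f w)) h) = algebraMap B (↥(cobordantAlgebra f w)) h := by
  rw [sigmaR_algebraMap, hσh]

/-- ★★★ **COBORDANT KILL CERTIFICATES LOCALISE.** For `σ h = h`, a certificate `g` for `(f, w, σ)` over `B` gives the certificate `cobordantMap g` for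
`(f/1, w, σ_h)` over `B[h⁻¹]` (`σ_h = sigmaAway σ`): (H1) because `R^w(B[h⁻¹]) = R^w(B)[h⁻¹]` with `σ_R` fixing `h`, (H2) because the vertex ideal and
the augmentation ideal extend. Chart rings of weighted blow-ups are such localisations (`ChartRing = R^w[(bT^d)⁻¹]`, `sigmaChart = sigmaAway σ_R`), so a
second-level certificate given once on `R^w` serves every chart of the move. [OURS · L1 W4.5c; NOT a statement of the manuscript] -/
theorem CobordantKillCert.away {g : ↥(cobordantAlgebra f w)} (hcert : CobordantKillCert f w σ hσJ hp hσp g) :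
    CobordantKillCert (algebraMap B (Localization.Away h) ∘ f) w (sigmaAway σ hσh)
      (map_sigmaAway_weightedFiltration_le f w σ hσh hσJ) hp (sigmaAway_iterate_eq_self σ hσh hσp) (cobordantMap f w h g) := by
  obtain ⟨h1, N, h2⟩ := hcert
  letI := (cobordantMap f w h).toAlgebra
  haveI : IsLocalization.Away (algebraMap B (↥(cobordantAlgebra f w)) h) (↥(cobordantAlgebra (algebraMap B (Localization.Away h) ∘ f) w)) :=
    isLocalization_away_cobordantMap f w h
  have halg : ∀ x, algebraMap (↥(cobordantAlgebra f w)) (↥(cobordantAlgebra (algebraMap B (Localization.Away h) ∘ f) w)) x =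
      cobordantMap f w h x := fun _ => rfl
  have hcompat : ∀ x, sigmaR (sigmaAway σ hσh) (algebraMap B (Localization.Away h) ∘ f) w (map_sigmaAway_weightedFiltration_le f w σ hσh hσJ) hp
        (sigmaAway_iterate_eq_self σ hσh hσp) (algebraMap _ (↥(cobordantAlgebra (algebraMap B (Localization.Away h) ∘ f) w)) x) =
      algebraMap _ (↥(cobordantAlgebra (algebraMap B (Localization.Away h) ∘ f) w)) (sigmaR σ f w hσJ hp hσp x) := fun x => by
    rw [halg, halg, cobordantMap_sigmaR]
  have hfix : ∀ m ∈ Submonoid.powers (algebraMap B (↥(cobordantAlgebra f w)) h), sigmaR σ f w hσJ hp hσp m = m := by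
    rintro _ ⟨k, rfl⟩
    rw [map_pow, sigmaR_algebraMap_of_fixed f w h σ hσJ hp hσp hσh]
  refine ⟨?_, N, ?_⟩
  · -- (H1)
    refine (augmentationIdeal_le_map_of_isLocalization (Submonoid.powers (algebraMap B (↥(cobordantAlgebra f w)) h)) _ _ hcompat hfix).trans ?_
    refine (Ideal.map_mono h1).trans ?_
    rw [Ideal.map_span, Set.image_singleton, halg]
  · -- (H2)
    have e1 : Ideal.span {cobordantMap f w h g} * cobordantAlgebra.vertexIdeal (algebraMap B (Localization.Away h) ∘ f) w ^ N =
        (Ideal.span {g} * cobordantAlgebra.vertexIdeal f w ^ N).map (cobordantMap f w h) := by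
      rw [Ideal.map_mul, Ideal.map_pow, map_vertexIdeal_cobordantMap, Ideal.map_span, Set.image_singleton]
    rw [e1]
    refine (Ideal.map_mono h2).trans ?_
    exact OneShotKill.map_augmentationIdeal_le (sigmaR σ f w hσJ hp hσp) _ hcompat

end Away

/-! ## v2: second-level certificates on the chart rings of a move -/

universe v

section Chart

variable {ι : Type v} [AddCommGroup ι] [DecidableEq ι] {B : Type u} [CommRing B] (𝒜 : ι → AddSubgroup B) [GradedRing 𝒜]
  {c : ℕ} (f : Fin c → B) (w : Fin c → ℕ) {d : ℕ} (b : ↥(𝒜 0)) (hb : b ∈ (traceFiltration 𝒜 f w).ideal d) (σ : B ≃+* B)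
  (hσJ : ∀ n : ℕ, ((weightedFiltration f w).ideal n).map (σ : B →+* B) ≤ (weightedFiltration f w).ideal n)
  {p : ℕ} (hp : 0 < p) (hσp : ∀ x : B, (⇑σ)^[p] x = x) (hσb : σ (b : B) = b)

/-- ★★ **SECOND-LEVEL CERTIFICATES ON THE CHART RINGS OF A MOVE.** A second-level weighted centre `(f', w')` given on the first-level cobordant algebra
`R^w` (σ_R-adapted) with a cobordant kill certificate `g` for `σ_R` yields, on EVERY σ-fixed chart ring `ChartRing 𝒜 f w d b hb = R^w[(bT^d)⁻¹]` of the
move, the certificate `cobordantMap g` for the image frame `(f'/1, w')` and the chart automorphism `sigmaChart` (which IS `sigmaAway σ_R` at the fixed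
cover element). With KC1/KC2 this is the kill clause of `RingKillData` on the chart node; two charts of the same move read ONE filtration.
[OURS · L1 W4.5c · FRAME-STATUS rev10 (F4); NOT a statement of the manuscript] -/
theorem CobordantKillCert.chart {c' : ℕ} (f' : Fin c' → ↥(cobordantAlgebra f w)) (w' : Fin c' → ℕ)
    (hσJ' : ∀ n : ℕ, ((weightedFiltration f' w').ideal n).map (sigmaR σ f w hσJ hp hσp : ↥(cobordantAlgebra f w) →+* ↥(cobordantAlgebra f w)) ≤
      (weightedFiltration f' w').ideal n)
    {g : ↥(cobordantAlgebra f' w')} (hcert : CobordantKillCert f' w' (sigmaR σ f w hσJ hp hσp) hσJ' hp (sigmaR_iterate_eq σ f w hσJ hp hσp) g) :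
    CobordantKillCert (algebraMap (↥(cobordantAlgebra f w)) (ChartRing 𝒜 f w d b hb) ∘ f') w' (sigmaChart 𝒜 f w d b hb σ hσJ hp hσp hσb)
      (map_sigmaAway_weightedFiltration_le f' w' (sigmaR σ f w hσJ hp hσp) (sigmaR_coverElement 𝒜 f w d b hb σ hσJ hp hσp hσb) hσJ') hp
      (sigmaChart_iterate 𝒜 f w d b hb σ hσJ hp hσp hσb) (cobordantMap f' w' (coverElement 𝒜 f w d b hb) g) :=
  CobordantKillCert.away f' w' (coverElement 𝒜 f w d b hb) (sigmaR σ f w hσJ hp hσp) hσJ' hp (sigmaR_iterate_eq σ f w hσJ hp hσp)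
    (sigmaR_coverElement 𝒜 f w d b hb σ hσJ hp hσp hσb) hcert

end Chart

end Summit.ResolutionOfSingularities.ResolutionOfSingularities.Theorems.WildQuotientResolution.S1.KillCert

end
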